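/-
Copyright (c) 2026 the pub-hodgecm-mathlib formalisation cell (harness21).  Prover seat hodgecm-mathlib-LH4-p01 (g12): road M6 → F5 → dyadic chain of `stub_DyUnramCore` (D-UNR),
site (L2-3) «THE WALL», row (A3)-θ of CENSUS-L23-CM v1 (LH10-p01 (g12)) — `Δ‴` under the HERMITIAN Cayley shift on conjugacy classes; 2026-09-03.
-/
import Literature.NumberTheory.Rogawski1990.FinExplicitTransferFactorCayleyShiftSum   -- ★ p846531 (F0P2-p02): the σ-fixed pair (pattern); brings ★ (b) `finExplicitDelta_eq_inv_sq_mul_of_log_eq` (shift-agnostic), `isLocalNormPair_of_isConj`, the `Δ‴`∕class API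
import Literature.NumberTheory.Rogawski1990.TypeTwoHermitianShiftCM                  -- ★ p853677 (this seat) «CM-SHIFT-θ»: `exists_unitary∕local_coe_eq_hermitianMoebius`, `coe_endoEmbLocal∕isLocalNormPair∕finGammaTwo_of_coe_eq_genMoebius`
import Literature.NumberTheory.Automorphic.MatrixGenMoebiusShift                      -- ★ p853671 (this seat): `genMoebius_neg_genMoebius` (`ψ ∘ φ = id`), `isUnit_det_neg_smul_genMoebius_add_smul_one`, `smul_genMoebius_add_neg_smul_one`, `genMoebius_mulVec_of_eigenvector_ring`
import HarnessLib

/-!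
# The HERMITIAN Cayley shift on conjugacy classes: `c ↦ ⟦φ_θ(out c)⟧` is a bijection from the classes matching `γ_H` onto the classes matching `u_H = φ_θ(γ_H)`, and the
# `Δ‴`-weighted orbital sums REINDEX along it with the factor `q_v⁻²` — the 2-free twin of ★ (A3) (Rogawski 1990 §4.9 Prop. 4.9.1; Kottwitz 1986 §3)

Topic `NumberTheory/Rogawski1990`; namespace `Literature.NumberTheory.Rogawski1990`.  THEOREMS ONLY (no definition, no instance, no notation, no named fact, no `sorry`);
kernel lane `--supports stmt-HodgeConjecture-24833`.  Cell `pub/hodgecm-mathlib` (D-0151), crux H413 = `stmt-HodgeConjecture-24833`; road M6 → F5 → the dyadic chain of organ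
(D-UNR) `stub_DyUnramCore`, LEVEL TWO, site (L2-3) «THE WALL» = ★ `liftInterior_of_levelTwo` with `h2` deleted.  ★ (A3) `FinExplicitTransferFactorCayleyShiftSum` (F0P2-p02
(g11)) is the σ-FIXED pair `φ_c = ((c+1)·_ + (c−1))((c−1)·_ + (c+1))⁻¹`, whose inverse needs `4c = (c+1)² − (c−1)²` a unit and whose LEVEL bookkeeping downstream needs
`|2|_w = 1`.  THIS FILE = ★ (A3) token for token with the HERMITIAN pair `φ_θ = (θ·_ + (c−θ)·1)((c−σθ)·_ + σθ·1)⁻¹` (`σ = conjLocal`, `σc = c`; LH10-p01 (g12)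
MEMO-L23-θSHIFT, CENSUS-L23-CM v1 «(A3) needs the hermitian shape restated»): `h4c : IsUnit ((c+1)² − (c−1)²)` ↦ `hΔ : IsUnit (θσθ − (c−θ)(c−σθ))` (`= c(1−c)`, ★ P2
`hermitianPair_key_scalar`), `ψ = φ_{σθ, −(c−θ) ∣ −(c−σθ), θ}` (★ `genMoebius_neg_genMoebius`), conjugation equivariance ★ P1 `moebius_conj'`, unitarity of `φ_θ`∕`ψ` of a
unitary ★ `exists_unitary_coe_eq_hermitianMoebius` (★ `conjLocal_conjLocal`), `ι_v`∕matching∕`γ₂`∕eigenvector transport ★ «CM-SHIFT-θ» p853677 + ★ p853671; the `Δ‴`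
identity itself is ★ (b) `finExplicitDelta_eq_inv_sq_mul_of_log_eq`, which is shift-agnostic (shared eigenvector + depth-sum drop `hm`).
  **`Σᶠ_c Δ‴_v(γ_H, out c)·F c = q_v⁻² · Σᶠ_{c′} Δ‴_v(u_H, out c′)·F′ c′`** for class functions `F, F′` agreeing on `φ_θ`-shifted pairs.
HONEST LABEL: HC_CM is proved only modulo the 7 printed citations (2 remaining: hLiu418 = stmt-HodgeConjecture-24832, h413 = stmt-HodgeConjecture-24833) until rung 0 closes;
count-neutral CM glue (zero label movement; L2-3 stays THE WALL until every row of CENSUS-L23-CM is paid); nothing printed is asserted here.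

* §1 per-pair lemmas: `isUnit_det_hermitianShift_denominators_of_isLocalNormPair`, `exists_hermitianShift_of_isLocalNormPair`, `finExplicitDelta_eq_inv_sq_mul_of_coe_eq_hermitianMoebius`;
* §2 the class map: `isConj_of_isConj_hermitianShift` (injective), `exists_isLocalNormPair_coe_eq_hermitianMoebius_of_isLocalNormPair_shift` (surjective),
  `isConj_hermitianShift_of_isConj` (well defined);
* §3 HEAD **`finsum_finExplicitDelta_mul_eq_inv_sq_mul_finsum_hermitianShift`** + the letter dress `finsum_finExplicitCollection_Δ_mul_eq_inv_sq_mul_finsum_hermitianShift`.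

## References
* [Rogawski1990] J. D. Rogawski, *Automorphic Representations of Unitary Groups in Three Variables*, Ann. of Math. Stud. 123 (1990), §4.9 Prop. 4.9.1 (a)(b) p. 55; §4.3
  (4.3.1)–(4.3.2) p. 43; §14.1 p. 232.
* [Kottwitz1986BaseChangeUnits] R. E. Kottwitz, *Base change for unit elements of Hecke algebras*, Compositio Math. 60 (1986), §3 (the shift on fixed lattices).
* [LanglandsShelstad1987] R. P. Langlands, D. Shelstad, *On the definition of transfer factors*, Math. Ann. 278 (1987), §1.3–1.4.
* [Weyl1939] H. Weyl, *The Classical Groups* (1939): Chap. II §10.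
-/

set_option autoImplicit false

noncomputable section

open NumberField IsDedekindDomain Matrix Polynomial
open scoped MatrixGroups WithZero

namespace Literature.NumberTheory.Rogawski1990

open Literature.NumberTheory.Automorphic Literature.NumberTheory.Automorphic.UnitaryGroup Literature.NumberTheory.Automorphic.MoebiusShift
open Literature.NumberTheory.GaloisRepresentations Literature.NumberTheory.NumberFields

variable (L : Type) [Field L] [NumberField L] [IsCMField L] (v : HeightOneSpectrum (𝓞 ↥(maximalRealSubfield L)))
  (H' : Matrix (Fin 3) (Fin 3) L) (w : PlacesOver L v) (hw : IsCMField.complexConj L • w.1 = w.1) (c θ : LocalRing L v)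
  (γH uH : (cmDatum L 2 (Matrix.of fun i j : Fin 2 => if i.val + j.val + 1 = 2 then (1 : L) else 0)).Local v ×
      (cmDatum L 1 (Matrix.of fun i j : Fin 1 => if i.val + j.val + 1 = 1 then (1 : L) else 0)).Local v)

/-! ## §1 Per-pair lemmas: denominators along a matching class, the shift exists, `Δ‴` under the shift -/

/-- **The denominator determinants are CLASS FUNCTIONS** (hermitian pair): for `x` matching `γ_H` (`ι_v(γ_H) ↔ x`), `det((c−σθ)•x + σθ•1)` and `det(θ•x + (c−θ)•1)` are units
as soon as they are at `ι_v(γ_H)` (★ `det_smul_conj_add_smul_one`). [cite: Rogawski1990, §14.1 p. 232] [cite: Kottwitz1986BaseChangeUnits, §3] -/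
theorem isUnit_det_hermitianShift_denominators_of_isLocalNormPair
    (hD : IsUnit ((c - conjLocal L (IsCMField.complexConj L) v θ) • (((endoEmbLocal L v γH).val : GL (Fin 3) (LocalRing L v)).val : Matrix (Fin 3) (Fin 3) (LocalRing L v)) + conjLocal L (IsCMField.complexConj L) v θ • (1 : Matrix (Fin 3) (Fin 3) (LocalRing L v))).det)
    (hN : IsUnit (θ • (((endoEmbLocal L v γH).val : GL (Fin 3) (LocalRing L v)).val : Matrix (Fin 3) (Fin 3) (LocalRing L v)) + (c - θ) • (1 : Matrix (Fin 3) (Fin 3) (LocalRing L v))).det)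
    {x : (cmDatum L 3 H').Local v} (hx : IsLocalNormPair L H' v γH x) :
    IsUnit ((c - conjLocal L (IsCMField.complexConj L) v θ) • ((x.val : GL (Fin 3) (LocalRing L v)).val : Matrix (Fin 3) (Fin 3) (LocalRing L v)) + conjLocal L (IsCMField.complexConj L) v θ • (1 : Matrix (Fin 3) (Fin 3) (LocalRing L v))).det ∧
      IsUnit (θ • ((x.val : GL (Fin 3) (LocalRing L v)).val : Matrix (Fin 3) (Fin 3) (LocalRing L v)) + (c - θ) • (1 : Matrix (Fin 3) (Fin 3) (LocalRing L v))).det := by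
  obtain ⟨P, hP⟩ := isConj_iff.1 hx
  have hxm : ((x.val : GL (Fin 3) (LocalRing L v)).val : Matrix (Fin 3) (Fin 3) (LocalRing L v)) =
      P.val * (((endoEmbLocal L v γH).val : GL (Fin 3) (LocalRing L v)).val : Matrix (Fin 3) (Fin 3) (LocalRing L v)) * P.val⁻¹ := by
    rw [← hP, Units.val_mul, Units.val_mul, Matrix.coe_units_inv]
    rfl
  rw [hxm, det_smul_conj_add_smul_one _ _ (Matrix.isUnits_det_units P), det_smul_conj_add_smul_one _ _ (Matrix.isUnits_det_units P)]
  exact ⟨hD, hN⟩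

/-- **THE HERMITIAN SHIFT OF A MATCHING ELEMENT EXISTS**: for `c` fixed by `σ_v` and `x` matching `γ_H` there is `y ∈ G′_v` with matrix `φ_θ(x)` (★ «CM-SHIFT-θ»
`exists_local_coe_eq_hermitianMoebius`; the denominators by the class-function lemma). [cite: Kottwitz1986BaseChangeUnits, §3] [cite: Rogawski1990, §4.9 Prop. 4.9.1 (b) p. 55] -/
theorem exists_hermitianShift_of_isLocalNormPair (hσc : conjLocal L (IsCMField.complexConj L) v c = c)
    (hD : IsUnit ((c - conjLocal L (IsCMField.complexConj L) v θ) • (((endoEmbLocal L v γH).val : GL (Fin 3) (LocalRing L v)).val : Matrix (Fin 3) (Fin 3) (LocalRing L v)) + conjLocal L (IsCMField.complexConj L) v θ • (1 : Matrix (Fin 3) (Fin 3) (LocalRing L v))).det)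
    (hN : IsUnit (θ • (((endoEmbLocal L v γH).val : GL (Fin 3) (LocalRing L v)).val : Matrix (Fin 3) (Fin 3) (LocalRing L v)) + (c - θ) • (1 : Matrix (Fin 3) (Fin 3) (LocalRing L v))).det)
    {x : (cmDatum L 3 H').Local v} (hx : IsLocalNormPair L H' v γH x) :
    ∃ y : (cmDatum L 3 H').Local v, ((y.val : GL (Fin 3) (LocalRing L v)).val : Matrix (Fin 3) (Fin 3) (LocalRing L v)) =
      (θ • ((x.val : GL (Fin 3) (LocalRing L v)).val : Matrix (Fin 3) (Fin 3) (LocalRing L v)) + (c - θ) • 1) *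
        ((c - conjLocal L (IsCMField.complexConj L) v θ) • ((x.val : GL (Fin 3) (LocalRing L v)).val : Matrix (Fin 3) (Fin 3) (LocalRing L v)) + conjLocal L (IsCMField.complexConj L) v θ • 1)⁻¹ := by
  obtain ⟨hDx, hNx⟩ := isUnit_det_hermitianShift_denominators_of_isLocalNormPair L v H' c θ γH hD hN hx
  exact exists_local_coe_eq_hermitianMoebius L v 3 H' x hσc hDx hNx

include hw in
open scoped Classical in
/-- **`Δ‴_v(γ_H, x) = q⁻²·Δ‴_v(u_H, y)` FOR THE HERMITIAN-SHIFTED PAIR `y = φ_θ(x)`** (`u_H = (φ_θ g, φ_θ u)` componentwise, both `G`-regular, depth sum dropping by two `hm`;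
unramified non-split `v`, `μ` unramified at `w` with the N7 guard): the `γ₂(γ_H)`-eigenvector of `x` is the `γ₂(u_H)`-eigenvector of `y` (★ `genMoebius_mulVec_of_eigenvector_ring` +
★ `finGammaTwo_of_coe_eq_genMoebius`), so ★ (b) `finExplicitDelta_eq_inv_sq_mul_of_log_eq` applies; `u_H ↔ y` by ★ `isLocalNormPair_of_coe_eq_genMoebius`.  ★
`finExplicitDelta_eq_inv_sq_mul_of_coe_eq_moebius` is the σ-fixed pair. [cite: Rogawski1990, §4.9 Prop. 4.9.1 (a)(b) p. 55; §4.3 (4.3.2) p. 43] [cite: Kottwitz1986BaseChangeUnits, §3] -/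
theorem finExplicitDelta_eq_inv_sq_mul_of_coe_eq_hermitianMoebius (μ : HeckeCharacter L)
    (hμω : ∀ x : ideleGroup ↥(maximalRealSubfield L), μ (AdeleRing.ideleBaseChange ↥(maximalRealSubfield L) L x) = quadraticHeckeCharCM L x)
    (hunr : Algebra.IsUnramifiedIn (𝓞 L) v.asIdeal) (hμ : μ.IsUnramifiedAt w.1)
    (hreg : IsLocalGRegular L v γH) (hreg' : IsLocalGRegular L v uH)
    (h1 : ((uH.1.val : GL (Fin 2) (LocalRing L v)).val : Matrix (Fin 2) (Fin 2) (LocalRing L v)) =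
      (θ • ((γH.1.val : GL (Fin 2) (LocalRing L v)).val : Matrix (Fin 2) (Fin 2) (LocalRing L v)) + (c - θ) • 1) *
        ((c - conjLocal L (IsCMField.complexConj L) v θ) • ((γH.1.val : GL (Fin 2) (LocalRing L v)).val : Matrix (Fin 2) (Fin 2) (LocalRing L v)) + conjLocal L (IsCMField.complexConj L) v θ • 1)⁻¹)
    (h2 : ((uH.2.val : GL (Fin 1) (LocalRing L v)).val : Matrix (Fin 1) (Fin 1) (LocalRing L v)) =
      (θ • ((γH.2.val : GL (Fin 1) (LocalRing L v)).val : Matrix (Fin 1) (Fin 1) (LocalRing L v)) + (c - θ) • 1) *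
        ((c - conjLocal L (IsCMField.complexConj L) v θ) • ((γH.2.val : GL (Fin 1) (LocalRing L v)).val : Matrix (Fin 1) (Fin 1) (LocalRing L v)) + conjLocal L (IsCMField.complexConj L) v θ • 1)⁻¹)
    (hD1 : IsUnit ((c - conjLocal L (IsCMField.complexConj L) v θ) • ((γH.1.val : GL (Fin 2) (LocalRing L v)).val : Matrix (Fin 2) (Fin 2) (LocalRing L v)) + conjLocal L (IsCMField.complexConj L) v θ • (1 : Matrix (Fin 2) (Fin 2) (LocalRing L v))).det)
    (hD2 : IsUnit ((c - conjLocal L (IsCMField.complexConj L) v θ) • ((γH.2.val : GL (Fin 1) (LocalRing L v)).val : Matrix (Fin 1) (Fin 1) (LocalRing L v)) + conjLocal L (IsCMField.complexConj L) v θ • (1 : Matrix (Fin 1) (Fin 1) (LocalRing L v))).det)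
    (hD : IsUnit ((c - conjLocal L (IsCMField.complexConj L) v θ) • (((endoEmbLocal L v γH).val : GL (Fin 3) (LocalRing L v)).val : Matrix (Fin 3) (Fin 3) (LocalRing L v)) + conjLocal L (IsCMField.complexConj L) v θ • (1 : Matrix (Fin 3) (Fin 3) (LocalRing L v))).det)
    (hN : IsUnit (θ • (((endoEmbLocal L v γH).val : GL (Fin 3) (LocalRing L v)).val : Matrix (Fin 3) (Fin 3) (LocalRing L v)) + (c - θ) • (1 : Matrix (Fin 3) (Fin 3) (LocalRing L v))).det)
    (hμ₂ : IsUnit ((c - conjLocal L (IsCMField.complexConj L) v θ) * finGammaTwo L v γH + conjLocal L (IsCMField.complexConj L) v θ))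
    (hm : WithZero.log (Valued.v (((finCharpolyTwo L v uH).eval (finGammaTwo L v uH)) w)) =
      WithZero.log (Valued.v (((finCharpolyTwo L v γH).eval (finGammaTwo L v γH)) w)) + 2)
    {x y : (cmDatum L 3 H').Local v} (hx : IsLocalNormPair L H' v γH x)
    (hy : ((y.val : GL (Fin 3) (LocalRing L v)).val : Matrix (Fin 3) (Fin 3) (LocalRing L v)) =
      (θ • ((x.val : GL (Fin 3) (LocalRing L v)).val : Matrix (Fin 3) (Fin 3) (LocalRing L v)) + (c - θ) • 1) *
        ((c - conjLocal L (IsCMField.complexConj L) v θ) • ((x.val : GL (Fin 3) (LocalRing L v)).val : Matrix (Fin 3) (Fin 3) (LocalRing L v)) + conjLocal L (IsCMField.complexConj L) v θ • 1)⁻¹) :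
    finExplicitDelta L v H' γH μ x = ((Ideal.absNorm v.asIdeal : ℂ) ^ 2)⁻¹ * finExplicitDelta L v H' uH μ y := by
  have hι := coe_endoEmbLocal_eq_genMoebius L v γH uH θ (c - θ) (conjLocal L (IsCMField.complexConj L) v θ) (c - conjLocal L (IsCMField.complexConj L) v θ) h1 h2 hD1 hD2
  have hy' : IsLocalNormPair L H' v uH y := isLocalNormPair_of_coe_eq_genMoebius L v H' γH uH x y θ (c - θ) (conjLocal L (IsCMField.complexConj L) v θ) (c - conjLocal L (IsCMField.complexConj L) v θ) hx hι hy hD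
  have hu0 : IsUnit ((finCharpolyTwo L v γH).eval (finGammaTwo L v γH)) := isUnit_eval_finCharpolyTwo_of_isLocalGRegular L v γH hreg
  have hu0' : IsUnit ((finCharpolyTwo L v uH).eval (finGammaTwo L v uH)) := isUnit_eval_finCharpolyTwo_of_isLocalGRegular L v uH hreg'
  obtain ⟨p', hne, hp'⟩ := exists_eigenvector_of_finKappaAt_ne_zero L v H' γH x hx (finKappaAt_ne_zero_of_isUnit L v H' γH x hx hu0)
  obtain ⟨hDx, -⟩ := isUnit_det_hermitianShift_denominators_of_isLocalNormPair L v H' c θ γH hD hN hx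
  have hγ₂ := finGammaTwo_of_coe_eq_genMoebius L v γH uH θ (c - θ) (conjLocal L (IsCMField.complexConj L) v θ) (c - conjLocal L (IsCMField.complexConj L) v θ) h2
  have hp'' : ((y.val.val : Matrix (Fin 3) (Fin 3) (LocalRing L v))) *ᵥ p' = finGammaTwo L v uH • p' := by
    rw [show (y.val.val : Matrix (Fin 3) (Fin 3) (LocalRing L v)) = ((y.val : GL (Fin 3) (LocalRing L v)).val : Matrix (Fin 3) (Fin 3) (LocalRing L v)) from rfl, hy, hγ₂,
      genMoebius_mulVec_of_eigenvector_ring hp' θ (c - θ) (conjLocal L (IsCMField.complexConj L) v θ) (c - conjLocal L (IsCMField.complexConj L) v θ) hμ₂ hDx]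
  exact finExplicitDelta_eq_inv_sq_mul_of_log_eq L v H' w hw μ hμω hunr hμ hx hy' hu0 hu0' hne hp' hp'' hm

/-! ## §2 The class map `⟦x⟧ ↦ ⟦φ_θ x⟧`: injective and surjective between the matching classes -/

/-- **INJECTIVE**: if `y₁ = φ_θ(x₁)`, `y₂ = φ_θ(x₂)` (as matrices, `xᵢ` matching `γ_H`) and `y₁ ∼ y₂` in `G′_v`, then `x₁ ∼ x₂` — conjugate `φ_θ(x₁)` by the same element
(★ P1 `moebius_conj'`) and undo `φ_θ` by `ψ = φ_{σθ,−(c−θ) ∣ −(c−σθ),θ}` (★ `genMoebius_neg_genMoebius`; needs `Δ = θσθ − (c−θ)(c−σθ)` a unit of `E_v`).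
[cite: Kottwitz1986BaseChangeUnits, §3] [cite: Rogawski1990, §4.9 Prop. 4.9.1 (b) p. 55] -/
theorem isConj_of_isConj_hermitianShift (hΔ : IsUnit (θ * conjLocal L (IsCMField.complexConj L) v θ - (c - θ) * (c - conjLocal L (IsCMField.complexConj L) v θ)))
    (hD : IsUnit ((c - conjLocal L (IsCMField.complexConj L) v θ) • (((endoEmbLocal L v γH).val : GL (Fin 3) (LocalRing L v)).val : Matrix (Fin 3) (Fin 3) (LocalRing L v)) + conjLocal L (IsCMField.complexConj L) v θ • (1 : Matrix (Fin 3) (Fin 3) (LocalRing L v))).det)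
    (hN : IsUnit (θ • (((endoEmbLocal L v γH).val : GL (Fin 3) (LocalRing L v)).val : Matrix (Fin 3) (Fin 3) (LocalRing L v)) + (c - θ) • (1 : Matrix (Fin 3) (Fin 3) (LocalRing L v))).det)
    {x₁ x₂ y₁ y₂ : (cmDatum L 3 H').Local v} (hx₁ : IsLocalNormPair L H' v γH x₁) (hx₂ : IsLocalNormPair L H' v γH x₂)
    (hy₁ : ((y₁.val : GL (Fin 3) (LocalRing L v)).val : Matrix (Fin 3) (Fin 3) (LocalRing L v)) =
      (θ • ((x₁.val : GL (Fin 3) (LocalRing L v)).val : Matrix (Fin 3) (Fin 3) (LocalRing L v)) + (c - θ) • 1) *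
        ((c - conjLocal L (IsCMField.complexConj L) v θ) • ((x₁.val : GL (Fin 3) (LocalRing L v)).val : Matrix (Fin 3) (Fin 3) (LocalRing L v)) + conjLocal L (IsCMField.complexConj L) v θ • 1)⁻¹)
    (hy₂ : ((y₂.val : GL (Fin 3) (LocalRing L v)).val : Matrix (Fin 3) (Fin 3) (LocalRing L v)) =
      (θ • ((x₂.val : GL (Fin 3) (LocalRing L v)).val : Matrix (Fin 3) (Fin 3) (LocalRing L v)) + (c - θ) • 1) *
        ((c - conjLocal L (IsCMField.complexConj L) v θ) • ((x₂.val : GL (Fin 3) (LocalRing L v)).val : Matrix (Fin 3) (Fin 3) (LocalRing L v)) + conjLocal L (IsCMField.complexConj L) v θ • 1)⁻¹)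
    (hyy : IsConj y₁ y₂) : IsConj x₁ x₂ := by
  obtain ⟨k, hk⟩ := isConj_iff.1 hyy
  refine isConj_iff.2 ⟨k, ?_⟩
  obtain ⟨hD₁, -⟩ := isUnit_det_hermitianShift_denominators_of_isLocalNormPair L v H' c θ γH hD hN hx₁
  obtain ⟨hD₂, -⟩ := isUnit_det_hermitianShift_denominators_of_isLocalNormPair L v H' c θ γH hD hN hx₂
  -- matrices of the conjugates
  have hkP : IsUnit ((k.val : GL (Fin 3) (LocalRing L v)).val : Matrix (Fin 3) (Fin 3) (LocalRing L v)).det := Matrix.isUnits_det_units _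
  have hcoex : (k * x₁ * k⁻¹).val = k.val * x₁.val * k.val⁻¹ := rfl
  have hcoey : (k * y₁ * k⁻¹).val = k.val * y₁.val * k.val⁻¹ := rfl
  have hkx : (((k * x₁ * k⁻¹).val : GL (Fin 3) (LocalRing L v)).val : Matrix (Fin 3) (Fin 3) (LocalRing L v)) =
      (k.val : GL (Fin 3) (LocalRing L v)).val * (x₁.val : GL (Fin 3) (LocalRing L v)).val * ((k.val : GL (Fin 3) (LocalRing L v)).val)⁻¹ := by
    rw [hcoex, Units.val_mul, Units.val_mul, Matrix.coe_units_inv]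
  have hky : (((k * y₁ * k⁻¹).val : GL (Fin 3) (LocalRing L v)).val : Matrix (Fin 3) (Fin 3) (LocalRing L v)) =
      (k.val : GL (Fin 3) (LocalRing L v)).val * (y₁.val : GL (Fin 3) (LocalRing L v)).val * ((k.val : GL (Fin 3) (LocalRing L v)).val)⁻¹ := by
    rw [hcoey, Units.val_mul, Units.val_mul, Matrix.coe_units_inv]
  -- the denominator at `k x₁ k⁻¹`
  have hD₁' : IsUnit ((c - conjLocal L (IsCMField.complexConj L) v θ) • ((k.val : GL (Fin 3) (LocalRing L v)).val * (x₁.val : GL (Fin 3) (LocalRing L v)).val * ((k.val : GL (Fin 3) (LocalRing L v)).val)⁻¹) +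
      conjLocal L (IsCMField.complexConj L) v θ • (1 : Matrix (Fin 3) (Fin 3) (LocalRing L v))).det := by
    rw [det_smul_conj_add_smul_one _ _ hkP]; exact hD₁
  -- `φ(k x₁ k⁻¹) = k φ(x₁) k⁻¹ = k y₁ k⁻¹ = y₂ = φ(x₂)`; undo `φ`
  have key : (k.val : GL (Fin 3) (LocalRing L v)).val * (x₁.val : GL (Fin 3) (LocalRing L v)).val * ((k.val : GL (Fin 3) (LocalRing L v)).val)⁻¹ =
      ((x₂.val : GL (Fin 3) (LocalRing L v)).val : Matrix (Fin 3) (Fin 3) (LocalRing L v)) := by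
    rw [← genMoebius_neg_genMoebius ((k.val : GL (Fin 3) (LocalRing L v)).val * (x₁.val : GL (Fin 3) (LocalRing L v)).val * ((k.val : GL (Fin 3) (LocalRing L v)).val)⁻¹) hΔ hD₁',
      ← genMoebius_neg_genMoebius ((x₂.val : GL (Fin 3) (LocalRing L v)).val : Matrix (Fin 3) (Fin 3) (LocalRing L v)) hΔ hD₂,
      moebius_conj' _ _ hkP _ _ _ _ hD₁, ← hy₁, ← hy₂, ← hky, hk]
  apply Subtype.ext
  apply Units.ext
  rw [hkx, key]

/-- **SURJECTIVE**: every `y′` matching `u_H` is the hermitian shift of some `x` matching `γ_H` — take `x = ψ(y′)` (a point of `G′_v`: ★ `exists_unitary_coe_eq_hermitianMoebius`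
at the pair `(σθ, −(c−θ) ∣ −(c−σθ), θ)`, denominators units because `y′ ∼ ι_v(u_H) = φ_θ(ι_v(γ_H))` and the `ψ`-denominators of a `φ_θ`-value are `Δ•D⁻¹`, `Δ•M·D⁻¹`),
then `φ_θ(x) = y′` and `x ∼ ψ(ι_v(u_H)) = ι_v(γ_H)` (★ `genMoebius_neg_genMoebius` twice, ★ P1 `moebius_conj'`).
[cite: Kottwitz1986BaseChangeUnits, §3] [cite: Rogawski1990, §4.9 Prop. 4.9.1 (b) p. 55; §14.1 p. 232] -/
theorem exists_isLocalNormPair_coe_eq_hermitianMoebius_of_isLocalNormPair_shift (hσc : conjLocal L (IsCMField.complexConj L) v c = c)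
    (hΔ : IsUnit (θ * conjLocal L (IsCMField.complexConj L) v θ - (c - θ) * (c - conjLocal L (IsCMField.complexConj L) v θ)))
    (hι : (((endoEmbLocal L v uH).val : GL (Fin 3) (LocalRing L v)).val : Matrix (Fin 3) (Fin 3) (LocalRing L v)) =
      (θ • (((endoEmbLocal L v γH).val : GL (Fin 3) (LocalRing L v)).val : Matrix (Fin 3) (Fin 3) (LocalRing L v)) + (c - θ) • 1) *
        ((c - conjLocal L (IsCMField.complexConj L) v θ) • (((endoEmbLocal L v γH).val : GL (Fin 3) (LocalRing L v)).val : Matrix (Fin 3) (Fin 3) (LocalRing L v)) + conjLocal L (IsCMField.complexConj L) v θ • 1)⁻¹)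
    (hD : IsUnit ((c - conjLocal L (IsCMField.complexConj L) v θ) • (((endoEmbLocal L v γH).val : GL (Fin 3) (LocalRing L v)).val : Matrix (Fin 3) (Fin 3) (LocalRing L v)) + conjLocal L (IsCMField.complexConj L) v θ • (1 : Matrix (Fin 3) (Fin 3) (LocalRing L v))).det)
    {y' : (cmDatum L 3 H').Local v} (hy' : IsLocalNormPair L H' v uH y') :
    ∃ x : (cmDatum L 3 H').Local v, IsLocalNormPair L H' v γH x ∧
      ((y'.val : GL (Fin 3) (LocalRing L v)).val : Matrix (Fin 3) (Fin 3) (LocalRing L v)) =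
        (θ • ((x.val : GL (Fin 3) (LocalRing L v)).val : Matrix (Fin 3) (Fin 3) (LocalRing L v)) + (c - θ) • 1) *
          ((c - conjLocal L (IsCMField.complexConj L) v θ) • ((x.val : GL (Fin 3) (LocalRing L v)).val : Matrix (Fin 3) (Fin 3) (LocalRing L v)) + conjLocal L (IsCMField.complexConj L) v θ • 1)⁻¹ := by
  -- abbreviations
  set M : Matrix (Fin 3) (Fin 3) (LocalRing L v) := (((endoEmbLocal L v γH).val : GL (Fin 3) (LocalRing L v)).val : Matrix (Fin 3) (Fin 3) (LocalRing L v)) with hM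
  set Y' : Matrix (Fin 3) (Fin 3) (LocalRing L v) := ((y'.val : GL (Fin 3) (LocalRing L v)).val : Matrix (Fin 3) (Fin 3) (LocalRing L v)) with hY'
  have hMdet : IsUnit M.det := Matrix.isUnits_det_units _
  have hσσ : conjLocal L (IsCMField.complexConj L) v (conjLocal L (IsCMField.complexConj L) v θ) = θ := conjLocal_conjLocal L v θ
  -- the `ψ`-denominators at `φ(M)` are units
  have hψD : IsUnit ((-(c - conjLocal L (IsCMField.complexConj L) v θ)) • ((θ • M + (c - θ) • 1) * ((c - conjLocal L (IsCMField.complexConj L) v θ) • M + conjLocal L (IsCMField.complexConj L) v θ • 1)⁻¹) + θ • (1 : Matrix (Fin 3) (Fin 3) (LocalRing L v))).det :=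
    isUnit_det_neg_smul_genMoebius_add_smul_one M hΔ hD
  have hψN : IsUnit (conjLocal L (IsCMField.complexConj L) v θ • ((θ • M + (c - θ) • 1) * ((c - conjLocal L (IsCMField.complexConj L) v θ) • M + conjLocal L (IsCMField.complexConj L) v θ • 1)⁻¹) + (-(c - θ)) • (1 : Matrix (Fin 3) (Fin 3) (LocalRing L v))).det := by
    rw [smul_genMoebius_add_neg_smul_one M θ (c - θ) (conjLocal L (IsCMField.complexConj L) v θ) (c - conjLocal L (IsCMField.complexConj L) v θ) hD, Matrix.det_smul, Matrix.det_mul]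
    exact (hΔ.pow _).mul (hMdet.mul ((Matrix.isUnit_nonsing_inv_det_iff (A := (c - conjLocal L (IsCMField.complexConj L) v θ) • M + conjLocal L (IsCMField.complexConj L) v θ • (1 : Matrix (Fin 3) (Fin 3) (LocalRing L v)))).2 hD))
  -- `y′ = P ι(u_H) P⁻¹ = P φ(M) P⁻¹`
  obtain ⟨P, hP⟩ := isConj_iff.1 hy'
  have hPdet : IsUnit (P.val : Matrix (Fin 3) (Fin 3) (LocalRing L v)).det := Matrix.isUnits_det_units P
  have hYm : Y' = P.val * ((θ • M + (c - θ) • 1) * ((c - conjLocal L (IsCMField.complexConj L) v θ) • M + conjLocal L (IsCMField.complexConj L) v θ • 1)⁻¹) * P.val⁻¹ := by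
    rw [hY', ← hP, Units.val_mul, Units.val_mul, Matrix.coe_units_inv]
    change (P.val : Matrix (Fin 3) (Fin 3) (LocalRing L v)) * (((endoEmbLocal L v uH).val : GL (Fin 3) (LocalRing L v)).val : Matrix (Fin 3) (Fin 3) (LocalRing L v)) * P.val⁻¹ = _
    rw [hι]
  -- hence the `ψ`-denominators at `Y′` are units
  have hψDY : IsUnit ((-(c - conjLocal L (IsCMField.complexConj L) v θ)) • Y' + θ • (1 : Matrix (Fin 3) (Fin 3) (LocalRing L v))).det := by
    rw [hYm, det_smul_conj_add_smul_one _ _ hPdet]; exact hψD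
  have hψNY : IsUnit (conjLocal L (IsCMField.complexConj L) v θ • Y' + (-(c - θ)) • (1 : Matrix (Fin 3) (Fin 3) (LocalRing L v))).det := by
    rw [hYm, det_smul_conj_add_smul_one _ _ hPdet]; exact hψN
  -- `x := ψ(y′) ∈ G′_v` (the pair `(σθ, −(c−θ))` is hermitian too: `σ(−(c−θ)) = −(c−σθ)`, `σ(σθ) = θ`)
  have hσb : conjLocal L (IsCMField.complexConj L) v (-(c - θ)) = -(c - conjLocal L (IsCMField.complexConj L) v θ) := by rw [map_neg, map_sub, hσc]
  have hψDY' : IsUnit (conjLocal L (IsCMField.complexConj L) v (-(c - θ)) • Y' + conjLocal L (IsCMField.complexConj L) v (conjLocal L (IsCMField.complexConj L) v θ) • (1 : Matrix (Fin 3) (Fin 3) (LocalRing L v))).det := by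
    rw [hσb, hσσ]; exact hψDY
  obtain ⟨x, hx⟩ := exists_unitary_coe_eq_hermitianMoebius (σ := conjLocal L (IsCMField.complexConj L) v) (conjLocal_conjLocal L v) y' (conjLocal L (IsCMField.complexConj L) v θ) (-(c - θ)) hψDY' hψNY
  rw [hσb, hσσ] at hx
  refine ⟨x, ?_, ?_⟩
  · -- `x = ψ(P φ(M) P⁻¹) = P ψ(φ M) P⁻¹ = P M P⁻¹`
    refine isConj_iff.2 ⟨P, Units.ext ?_⟩
    rw [Units.val_mul, Units.val_mul, Matrix.coe_units_inv]
    change (P.val : Matrix (Fin 3) (Fin 3) (LocalRing L v)) * M * P.val⁻¹ = ((x.val : GL (Fin 3) (LocalRing L v)).val : Matrix (Fin 3) (Fin 3) (LocalRing L v))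
    rw [← hY'] at hx
    rw [hx, hYm, moebius_conj' _ _ hPdet _ _ _ _ hψD, genMoebius_neg_genMoebius M hΔ hD]
  · -- `φ(x) = φ(ψ(Y′)) = Y′`
    rw [← hY'] at hx
    rw [hx]
    have hΔ' : IsUnit (conjLocal L (IsCMField.complexConj L) v θ * θ - (-(c - θ)) * (-(c - conjLocal L (IsCMField.complexConj L) v θ))) := by
      have e : conjLocal L (IsCMField.complexConj L) v θ * θ - (-(c - θ)) * (-(c - conjLocal L (IsCMField.complexConj L) v θ)) = θ * conjLocal L (IsCMField.complexConj L) v θ - (c - θ) * (c - conjLocal L (IsCMField.complexConj L) v θ) := by ring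
      rw [e]; exact hΔ
    have key := genMoebius_neg_genMoebius Y' hΔ' hψDY
    rw [neg_neg, neg_neg] at key
    exact key.symm

/-- **FORWARD: conjugate matching elements have conjugate hermitian shifts** — `φ_θ(k x k⁻¹) = k φ_θ(x) k⁻¹` (★ P1 `moebius_conj'`), so the class of the shift depends only on
the class of `x` (the class map is WELL DEFINED). [cite: Kottwitz1986BaseChangeUnits, §3] [cite: Rogawski1990, §4.9 Prop. 4.9.1 (b) p. 55] -/
theorem isConj_hermitianShift_of_isConj
    (hD : IsUnit ((c - conjLocal L (IsCMField.complexConj L) v θ) • (((endoEmbLocal L v γH).val : GL (Fin 3) (LocalRing L v)).val : Matrix (Fin 3) (Fin 3) (LocalRing L v)) + conjLocal L (IsCMField.complexConj L) v θ • (1 : Matrix (Fin 3) (Fin 3) (LocalRing L v))).det)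
    (hN : IsUnit (θ • (((endoEmbLocal L v γH).val : GL (Fin 3) (LocalRing L v)).val : Matrix (Fin 3) (Fin 3) (LocalRing L v)) + (c - θ) • (1 : Matrix (Fin 3) (Fin 3) (LocalRing L v))).det)
    {x₁ x₂ y₁ y₂ : (cmDatum L 3 H').Local v} (hx₁ : IsLocalNormPair L H' v γH x₁)
    (hy₁ : ((y₁.val : GL (Fin 3) (LocalRing L v)).val : Matrix (Fin 3) (Fin 3) (LocalRing L v)) =
      (θ • ((x₁.val : GL (Fin 3) (LocalRing L v)).val : Matrix (Fin 3) (Fin 3) (LocalRing L v)) + (c - θ) • 1) *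
        ((c - conjLocal L (IsCMField.complexConj L) v θ) • ((x₁.val : GL (Fin 3) (LocalRing L v)).val : Matrix (Fin 3) (Fin 3) (LocalRing L v)) + conjLocal L (IsCMField.complexConj L) v θ • 1)⁻¹)
    (hy₂ : ((y₂.val : GL (Fin 3) (LocalRing L v)).val : Matrix (Fin 3) (Fin 3) (LocalRing L v)) =
      (θ • ((x₂.val : GL (Fin 3) (LocalRing L v)).val : Matrix (Fin 3) (Fin 3) (LocalRing L v)) + (c - θ) • 1) *
        ((c - conjLocal L (IsCMField.complexConj L) v θ) • ((x₂.val : GL (Fin 3) (LocalRing L v)).val : Matrix (Fin 3) (Fin 3) (LocalRing L v)) + conjLocal L (IsCMField.complexConj L) v θ • 1)⁻¹)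
    (hxx : IsConj x₁ x₂) : IsConj y₁ y₂ := by
  obtain ⟨k, hk⟩ := isConj_iff.1 hxx
  refine isConj_iff.2 ⟨k, ?_⟩
  obtain ⟨hD₁, -⟩ := isUnit_det_hermitianShift_denominators_of_isLocalNormPair L v H' c θ γH hD hN hx₁
  have hkP : IsUnit ((k.val : GL (Fin 3) (LocalRing L v)).val : Matrix (Fin 3) (Fin 3) (LocalRing L v)).det := Matrix.isUnits_det_units _
  have hcoex : (k * x₁ * k⁻¹).val = k.val * x₁.val * k.val⁻¹ := rfl
  have hcoey : (k * y₁ * k⁻¹).val = k.val * y₁.val * k.val⁻¹ := rfl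
  have hkx : ((x₂.val : GL (Fin 3) (LocalRing L v)).val : Matrix (Fin 3) (Fin 3) (LocalRing L v)) =
      (k.val : GL (Fin 3) (LocalRing L v)).val * (x₁.val : GL (Fin 3) (LocalRing L v)).val * ((k.val : GL (Fin 3) (LocalRing L v)).val)⁻¹ := by
    rw [← hk, hcoex, Units.val_mul, Units.val_mul, Matrix.coe_units_inv]
  apply Subtype.ext
  apply Units.ext
  rw [hcoey, Units.val_mul, Units.val_mul, Matrix.coe_units_inv, hy₂, hkx, moebius_conj' _ _ hkP _ _ _ _ hD₁, ← hy₁]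

/-! ## §3 HEAD: the `Δ‴`-weighted orbital sums reindex along the hermitian class shift, with the factor `q_v⁻²` -/

include hw in
open scoped Classical in
/-- **HEAD (A3)-θ — THE `Δ‴`-WEIGHTED SUM REINDEXES UNDER THE HERMITIAN CAYLEY SHIFT WITH THE FACTOR `q_v⁻²`** (any residue characteristic).  `v` unramified non-split
(`w ∣ v`, `σw = w`), `μ` unramified at `w` restricting to `ω_{L/L⁺}`; `c ∈ E_v` `σ`-fixed, `θ ∈ E_v` with `Δ = θσθ − (c−θ)(c−σθ)` a unit (for `θ + σθ = 1`: `Δ = c(1−c)`);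
`γ_H`, `u_H ∈ H_v` both `G`-regular, `u_H = (φ_θ g, φ_θ u)` the componentwise shift of `γ_H = (g, u)` (`h1 h2`, denominators `hD1 hD2`), the `3 × 3` denominators of `ι_v(γ_H)`
units (`hD hN`), `(c−σθ)γ₂ + σθ` a unit and the depth sum dropping by two (`hm`).  Then for ANY `F, F′ : {classes of G′_v} → ℂ` with `F ⟦x⟧ = F′ ⟦y⟧` whenever `x` matches
`γ_H` and `y = φ_θ(x)` on matrices:  `Σᶠ_c Δ‴_v(γ_H, out c)·F c = q_v⁻² · Σᶠ_{c′} Δ‴_v(u_H, out c′)·F′ c′`.  Proof = ★ (A3)'s verbatim: both `Δ‴` vanish off the matching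
classes (★ `finExplicitDelta_of_not_isLocalNormPair`); on them `c ↦ ⟦φ_θ(out c)⟧` is a bijection onto the classes matching `u_H` (§2) along which `Δ‴_v(γ_H, out c) =
q⁻²·Δ‴_v(u_H, out c′)` (§1 + ★ `finExplicitDelta_conj_right_all`) and `F c = F′ c′`; `finsum_mem_eq_of_bijOn`.  ★ `finsum_finExplicitDelta_mul_eq_inv_sq_mul_finsum_shift` is the
σ-fixed pair under `IsUnit (4c)`. [cite: Rogawski1990, §4.9 Prop. 4.9.1 (a)(b) p. 55; §4.3 (4.3.1)–(4.3.2) p. 43] [cite: Kottwitz1986BaseChangeUnits, §3] [cite: LanglandsShelstad1987, §1.3] -/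
theorem finsum_finExplicitDelta_mul_eq_inv_sq_mul_finsum_hermitianShift (μ : HeckeCharacter L)
    (hμω : ∀ x : ideleGroup ↥(maximalRealSubfield L), μ (AdeleRing.ideleBaseChange ↥(maximalRealSubfield L) L x) = quadraticHeckeCharCM L x)
    (hunr : Algebra.IsUnramifiedIn (𝓞 L) v.asIdeal) (hμ : μ.IsUnramifiedAt w.1)
    (hσc : conjLocal L (IsCMField.complexConj L) v c = c) (hΔ : IsUnit (θ * conjLocal L (IsCMField.complexConj L) v θ - (c - θ) * (c - conjLocal L (IsCMField.complexConj L) v θ)))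
    (hreg : IsLocalGRegular L v γH) (hreg' : IsLocalGRegular L v uH)
    (h1 : ((uH.1.val : GL (Fin 2) (LocalRing L v)).val : Matrix (Fin 2) (Fin 2) (LocalRing L v)) =
      (θ • ((γH.1.val : GL (Fin 2) (LocalRing L v)).val : Matrix (Fin 2) (Fin 2) (LocalRing L v)) + (c - θ) • 1) *
        ((c - conjLocal L (IsCMField.complexConj L) v θ) • ((γH.1.val : GL (Fin 2) (LocalRing L v)).val : Matrix (Fin 2) (Fin 2) (LocalRing L v)) + conjLocal L (IsCMField.complexConj L) v θ • 1)⁻¹)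
    (h2 : ((uH.2.val : GL (Fin 1) (LocalRing L v)).val : Matrix (Fin 1) (Fin 1) (LocalRing L v)) =
      (θ • ((γH.2.val : GL (Fin 1) (LocalRing L v)).val : Matrix (Fin 1) (Fin 1) (LocalRing L v)) + (c - θ) • 1) *
        ((c - conjLocal L (IsCMField.complexConj L) v θ) • ((γH.2.val : GL (Fin 1) (LocalRing L v)).val : Matrix (Fin 1) (Fin 1) (LocalRing L v)) + conjLocal L (IsCMField.complexConj L) v θ • 1)⁻¹)
    (hD1 : IsUnit ((c - conjLocal L (IsCMField.complexConj L) v θ) • ((γH.1.val : GL (Fin 2) (LocalRing L v)).val : Matrix (Fin 2) (Fin 2) (LocalRing L v)) + conjLocal L (IsCMField.complexConj L) v θ • (1 : Matrix (Fin 2) (Fin 2) (LocalRing L v))).det)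
    (hD2 : IsUnit ((c - conjLocal L (IsCMField.complexConj L) v θ) • ((γH.2.val : GL (Fin 1) (LocalRing L v)).val : Matrix (Fin 1) (Fin 1) (LocalRing L v)) + conjLocal L (IsCMField.complexConj L) v θ • (1 : Matrix (Fin 1) (Fin 1) (LocalRing L v))).det)
    (hD : IsUnit ((c - conjLocal L (IsCMField.complexConj L) v θ) • (((endoEmbLocal L v γH).val : GL (Fin 3) (LocalRing L v)).val : Matrix (Fin 3) (Fin 3) (LocalRing L v)) + conjLocal L (IsCMField.complexConj L) v θ • (1 : Matrix (Fin 3) (Fin 3) (LocalRing L v))).det)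
    (hN : IsUnit (θ • (((endoEmbLocal L v γH).val : GL (Fin 3) (LocalRing L v)).val : Matrix (Fin 3) (Fin 3) (LocalRing L v)) + (c - θ) • (1 : Matrix (Fin 3) (Fin 3) (LocalRing L v))).det)
    (hμ₂ : IsUnit ((c - conjLocal L (IsCMField.complexConj L) v θ) * finGammaTwo L v γH + conjLocal L (IsCMField.complexConj L) v θ))
    (hm : WithZero.log (Valued.v (((finCharpolyTwo L v uH).eval (finGammaTwo L v uH)) w)) =
      WithZero.log (Valued.v (((finCharpolyTwo L v γH).eval (finGammaTwo L v γH)) w)) + 2)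
    (F F' : ConjClasses ((cmDatum L 3 H').Local v) → ℂ)
    (hF : ∀ x y : (cmDatum L 3 H').Local v, IsLocalNormPair L H' v γH x →
      ((y.val : GL (Fin 3) (LocalRing L v)).val : Matrix (Fin 3) (Fin 3) (LocalRing L v)) =
        (θ • ((x.val : GL (Fin 3) (LocalRing L v)).val : Matrix (Fin 3) (Fin 3) (LocalRing L v)) + (c - θ) • 1) *
          ((c - conjLocal L (IsCMField.complexConj L) v θ) • ((x.val : GL (Fin 3) (LocalRing L v)).val : Matrix (Fin 3) (Fin 3) (LocalRing L v)) + conjLocal L (IsCMField.complexConj L) v θ • 1)⁻¹ →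
      F (ConjClasses.mk x) = F' (ConjClasses.mk y)) :
    ∑ᶠ cG : ConjClasses ((cmDatum L 3 H').Local v), finExplicitDelta L v H' γH μ (Quotient.out cG) * F cG =
      ((Ideal.absNorm v.asIdeal : ℂ) ^ 2)⁻¹ *
        ∑ᶠ cG : ConjClasses ((cmDatum L 3 H').Local v), finExplicitDelta L v H' uH μ (Quotient.out cG) * F' cG := by
  have hι := coe_endoEmbLocal_eq_genMoebius L v γH uH θ (c - θ) (conjLocal L (IsCMField.complexConj L) v θ) (c - conjLocal L (IsCMField.complexConj L) v θ) h1 h2 hD1 hD2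
  -- the shift of a matching element (a choice) and its matrix
  let sh : ∀ x : (cmDatum L 3 H').Local v, IsLocalNormPair L H' v γH x → (cmDatum L 3 H').Local v :=
    fun x hx => Classical.choose (exists_hermitianShift_of_isLocalNormPair L v H' c θ γH hσc hD hN hx)
  have hsh : ∀ (x : (cmDatum L 3 H').Local v) (hx : IsLocalNormPair L H' v γH x),
      (((sh x hx).val : GL (Fin 3) (LocalRing L v)).val : Matrix (Fin 3) (Fin 3) (LocalRing L v)) =
        (θ • ((x.val : GL (Fin 3) (LocalRing L v)).val : Matrix (Fin 3) (Fin 3) (LocalRing L v)) + (c - θ) • 1) *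
          ((c - conjLocal L (IsCMField.complexConj L) v θ) • ((x.val : GL (Fin 3) (LocalRing L v)).val : Matrix (Fin 3) (Fin 3) (LocalRing L v)) + conjLocal L (IsCMField.complexConj L) v θ • 1)⁻¹ :=
    fun x hx => Classical.choose_spec (exists_hermitianShift_of_isLocalNormPair L v H' c θ γH hσc hD hN hx)
  -- representatives
  have hout : ∀ x : (cmDatum L 3 H').Local v, IsConj x (Quotient.out (ConjClasses.mk x)) := fun x =>
    ConjClasses.mk_eq_mk_iff_isConj.1 (Quotient.out_eq (ConjClasses.mk x)).symm
  have hmk : ∀ cG : ConjClasses ((cmDatum L 3 H').Local v), ConjClasses.mk (Quotient.out cG) = cG := fun cG => Quotient.out_eq cG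
  -- the class map and the two index sets
  let Θ : ConjClasses ((cmDatum L 3 H').Local v) → ConjClasses ((cmDatum L 3 H').Local v) := fun cG =>
    if h : IsLocalNormPair L H' v γH (Quotient.out cG) then ConjClasses.mk (sh _ h) else cG
  have hΘ : ∀ (cG : ConjClasses ((cmDatum L 3 H').Local v)) (h : IsLocalNormPair L H' v γH (Quotient.out cG)), Θ cG = ConjClasses.mk (sh _ h) :=
    fun cG h => dif_pos h
  set S : Set (ConjClasses ((cmDatum L 3 H').Local v)) := {cG | IsLocalNormPair L H' v γH (Quotient.out cG)} with hS
  set S' : Set (ConjClasses ((cmDatum L 3 H').Local v)) := {cG | IsLocalNormPair L H' v uH (Quotient.out cG)} with hS'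
  -- §2: `Θ` is a bijection from `S` onto `S′`
  have hbij : Set.BijOn Θ S S' := by
    refine ⟨fun cG hcG => ?_, fun cG₁ hcG₁ cG₂ hcG₂ hΘeq => ?_, fun cG' hcG' => ?_⟩
    · have h : IsLocalNormPair L H' v γH (Quotient.out cG) := hcG
      show IsLocalNormPair L H' v uH (Quotient.out (Θ cG))
      rw [hΘ cG h]
      exact isLocalNormPair_of_isConj L v H' uH (isLocalNormPair_of_coe_eq_genMoebius L v H' γH uH _ _ θ (c - θ) (conjLocal L (IsCMField.complexConj L) v θ) (c - conjLocal L (IsCMField.complexConj L) v θ) h hι (hsh _ h) hD) (hout _)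
    · have h₁ : IsLocalNormPair L H' v γH (Quotient.out cG₁) := hcG₁
      have h₂ : IsLocalNormPair L H' v γH (Quotient.out cG₂) := hcG₂
      rw [hΘ cG₁ h₁, hΘ cG₂ h₂, ConjClasses.mk_eq_mk_iff_isConj] at hΘeq
      rw [← hmk cG₁, ← hmk cG₂, ConjClasses.mk_eq_mk_iff_isConj]
      exact isConj_of_isConj_hermitianShift L v H' c θ γH hΔ hD hN h₁ h₂ (hsh _ h₁) (hsh _ h₂) hΘeq
    · have h' : IsLocalNormPair L H' v uH (Quotient.out cG') := hcG'
      obtain ⟨x, hx, hxy⟩ := exists_isLocalNormPair_coe_eq_hermitianMoebius_of_isLocalNormPair_shift L v H' c θ γH uH hσc hΔ hι hD h'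
      have hx' : IsLocalNormPair L H' v γH (Quotient.out (ConjClasses.mk x)) := isLocalNormPair_of_isConj L v H' γH hx (hout x)
      refine ⟨ConjClasses.mk x, hx', ?_⟩
      rw [hΘ _ hx', ← hmk cG', ConjClasses.mk_eq_mk_iff_isConj]
      exact isConj_hermitianShift_of_isConj L v H' c θ γH hD hN hx' (hsh _ hx') hxy (hout x).symm
  -- §1: the summands agree along `Θ`, with the factor `q⁻²`
  have hsummand : ∀ cG ∈ S, finExplicitDelta L v H' γH μ (Quotient.out cG) * F cG =
      ((Ideal.absNorm v.asIdeal : ℂ) ^ 2)⁻¹ * (finExplicitDelta L v H' uH μ (Quotient.out (Θ cG)) * F' (Θ cG)) := by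
    intro cG hcG
    have h : IsLocalNormPair L H' v γH (Quotient.out cG) := hcG
    have hΔ1 := finExplicitDelta_eq_inv_sq_mul_of_coe_eq_hermitianMoebius L v H' w hw c θ γH uH μ hμω hunr hμ hreg hreg' h1 h2 hD1 hD2 hD hN hμ₂ hm h (hsh _ h)
    obtain ⟨k, hk⟩ := isConj_iff.1 (hout (sh _ h))
    have hΔ' : finExplicitDelta L v H' uH μ (Quotient.out (Θ cG)) = finExplicitDelta L v H' uH μ (sh _ h) := by
      rw [hΘ cG h, ← hk]
      exact finExplicitDelta_conj_right_all L H' μ v uH (sh _ h) k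
    have hFF : F cG = F' (Θ cG) := by
      rw [hΘ cG h, ← hF _ _ h (hsh _ h), hmk]
    rw [hΔ', hFF, hΔ1, mul_assoc]
  -- both sums live on the matching classes
  have hL : (∑ᶠ cG : ConjClasses ((cmDatum L 3 H').Local v), finExplicitDelta L v H' γH μ (Quotient.out cG) * F cG) =
      ∑ᶠ cG ∈ S, finExplicitDelta L v H' γH μ (Quotient.out cG) * F cG := by
    rw [finsum_mem_def]
    refine finsum_congr fun cG => ?_
    by_cases h : cG ∈ S
    · rw [Set.indicator_of_mem h]
    · have h0 : ¬ IsLocalNormPair L H' v γH (Quotient.out cG) := h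
      rw [Set.indicator_of_notMem h, finExplicitDelta_of_not_isLocalNormPair L v H' γH μ h0, zero_mul]
  have hR : (∑ᶠ cG : ConjClasses ((cmDatum L 3 H').Local v), finExplicitDelta L v H' uH μ (Quotient.out cG) * F' cG) =
      ∑ᶠ cG ∈ S', finExplicitDelta L v H' uH μ (Quotient.out cG) * F' cG := by
    rw [finsum_mem_def]
    refine finsum_congr fun cG => ?_
    by_cases h : cG ∈ S'
    · rw [Set.indicator_of_mem h]
    · have h0 : ¬ IsLocalNormPair L H' v uH (Quotient.out cG) := h
      rw [Set.indicator_of_notMem h, finExplicitDelta_of_not_isLocalNormPair L v H' uH μ h0, zero_mul]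
  rw [hL, hR, mul_finsum_mem]
  exact finsum_mem_eq_of_bijOn Θ hbij hsummand

include hw in
open scoped Classical in
/-- The same in the LETTER SPELLING of the S3-tree heads (`((finExplicitCollection L H′ μ …) v).Δ`, ★ `finExplicitCollection_Δ` is `rfl`):
`Σᶠ_c ((finExplicitCollection L H′ μ …) v).Δ γ_H (out c)·F c = (((#k(v) : ℕ) : ℂ)²)⁻¹ · Σᶠ_{c′} ((finExplicitCollection L H′ μ …) v).Δ u_H (out c′)·F′ c′` — the socket the 2-free
organ (I) reads with `F = Φ(·, g_int)`, `F′ = Φ(·, g′)`. [cite: Rogawski1990, §4.9 Prop. 4.9.1 (a)(b) p. 55; §4.3 (4.3.1) p. 43] [cite: Kottwitz1986BaseChangeUnits, §3] -/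
theorem finsum_finExplicitCollection_Δ_mul_eq_inv_sq_mul_finsum_hermitianShift (μ : HeckeCharacter L)
    (hμω : ∀ x : ideleGroup ↥(maximalRealSubfield L), μ (AdeleRing.ideleBaseChange ↥(maximalRealSubfield L) L x) = quadraticHeckeCharCM L x)
    (hunr : Algebra.IsUnramifiedIn (𝓞 L) v.asIdeal) (hμ : μ.IsUnramifiedAt w.1)
    (hσc : conjLocal L (IsCMField.complexConj L) v c = c) (hΔ : IsUnit (θ * conjLocal L (IsCMField.complexConj L) v θ - (c - θ) * (c - conjLocal L (IsCMField.complexConj L) v θ)))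
    (hreg : IsLocalGRegular L v γH) (hreg' : IsLocalGRegular L v uH)
    (h1 : ((uH.1.val : GL (Fin 2) (LocalRing L v)).val : Matrix (Fin 2) (Fin 2) (LocalRing L v)) =
      (θ • ((γH.1.val : GL (Fin 2) (LocalRing L v)).val : Matrix (Fin 2) (Fin 2) (LocalRing L v)) + (c - θ) • 1) *
        ((c - conjLocal L (IsCMField.complexConj L) v θ) • ((γH.1.val : GL (Fin 2) (LocalRing L v)).val : Matrix (Fin 2) (Fin 2) (LocalRing L v)) + conjLocal L (IsCMField.complexConj L) v θ • 1)⁻¹)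
    (h2 : ((uH.2.val : GL (Fin 1) (LocalRing L v)).val : Matrix (Fin 1) (Fin 1) (LocalRing L v)) =
      (θ • ((γH.2.val : GL (Fin 1) (LocalRing L v)).val : Matrix (Fin 1) (Fin 1) (LocalRing L v)) + (c - θ) • 1) *
        ((c - conjLocal L (IsCMField.complexConj L) v θ) • ((γH.2.val : GL (Fin 1) (LocalRing L v)).val : Matrix (Fin 1) (Fin 1) (LocalRing L v)) + conjLocal L (IsCMField.complexConj L) v θ • 1)⁻¹)
    (hD1 : IsUnit ((c - conjLocal L (IsCMField.complexConj L) v θ) • ((γH.1.val : GL (Fin 2) (LocalRing L v)).val : Matrix (Fin 2) (Fin 2) (LocalRing L v)) + conjLocal L (IsCMField.complexConj L) v θ • (1 : Matrix (Fin 2) (Fin 2) (LocalRing L v))).det)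
    (hD2 : IsUnit ((c - conjLocal L (IsCMField.complexConj L) v θ) • ((γH.2.val : GL (Fin 1) (LocalRing L v)).val : Matrix (Fin 1) (Fin 1) (LocalRing L v)) + conjLocal L (IsCMField.complexConj L) v θ • (1 : Matrix (Fin 1) (Fin 1) (LocalRing L v))).det)
    (hD : IsUnit ((c - conjLocal L (IsCMField.complexConj L) v θ) • (((endoEmbLocal L v γH).val : GL (Fin 3) (LocalRing L v)).val : Matrix (Fin 3) (Fin 3) (LocalRing L v)) + conjLocal L (IsCMField.complexConj L) v θ • (1 : Matrix (Fin 3) (Fin 3) (LocalRing L v))).det)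
    (hN : IsUnit (θ • (((endoEmbLocal L v γH).val : GL (Fin 3) (LocalRing L v)).val : Matrix (Fin 3) (Fin 3) (LocalRing L v)) + (c - θ) • (1 : Matrix (Fin 3) (Fin 3) (LocalRing L v))).det)
    (hμ₂ : IsUnit ((c - conjLocal L (IsCMField.complexConj L) v θ) * finGammaTwo L v γH + conjLocal L (IsCMField.complexConj L) v θ))
    (hm : WithZero.log (Valued.v (((finCharpolyTwo L v uH).eval (finGammaTwo L v uH)) w)) =
      WithZero.log (Valued.v (((finCharpolyTwo L v γH).eval (finGammaTwo L v γH)) w)) + 2)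
    (F F' : ConjClasses ((cmDatum L 3 H').Local v) → ℂ)
    (hF : ∀ x y : (cmDatum L 3 H').Local v, IsLocalNormPair L H' v γH x →
      ((y.val : GL (Fin 3) (LocalRing L v)).val : Matrix (Fin 3) (Fin 3) (LocalRing L v)) =
        (θ • ((x.val : GL (Fin 3) (LocalRing L v)).val : Matrix (Fin 3) (Fin 3) (LocalRing L v)) + (c - θ) • 1) *
          ((c - conjLocal L (IsCMField.complexConj L) v θ) • ((x.val : GL (Fin 3) (LocalRing L v)).val : Matrix (Fin 3) (Fin 3) (LocalRing L v)) + conjLocal L (IsCMField.complexConj L) v θ • 1)⁻¹ →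
      F (ConjClasses.mk x) = F' (ConjClasses.mk y)) :
    (∑ᶠ cG : ConjClasses ((cmDatum L 3 H').Local v),
        ((finExplicitCollection L H' μ (finExplicitDelta_conj_left_all L H' μ) (finExplicitDelta_conj_right_all L H' μ)) v).Δ γH (Quotient.out cG) * F cG) =
      (((Ideal.absNorm v.asIdeal : ℕ) : ℂ) ^ 2)⁻¹ *
        (∑ᶠ cG : ConjClasses ((cmDatum L 3 H').Local v),
          ((finExplicitCollection L H' μ (finExplicitDelta_conj_left_all L H' μ) (finExplicitDelta_conj_right_all L H' μ)) v).Δ uH (Quotient.out cG) * F' cG) :=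
  finsum_finExplicitDelta_mul_eq_inv_sq_mul_finsum_hermitianShift L v H' w hw c θ γH uH μ hμω hunr hμ hσc hΔ hreg hreg' h1 h2 hD1 hD2 hD hN hμ₂ hm F F' hF

end Literature.NumberTheory.Rogawski1990

end
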